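import Literature.Topology.FourManifolds.TrisectionsLinkCondition
import Literature.Topology.FourManifolds.TrisectionsHandlebodyH23Charts
import Literature.Topology.FourManifolds.TrisectionsHandleBoxes
import HarnessLib

/-!
# The tube frame of the trisection construction: the `2`-handle boxes of the un-normalised
# gradient-like field, the low lid, and the Heegaard function on the thin tubes

Topic `Literature/Topology/FourManifolds`; for the fact seat
`provefact-Literature.Topology.FourManifolds.exists_isBalancedGKTrisection` (Gay–Kirby 2016,
Thm. 4 via §4, Lemma 14).  Everything in this file is **proved**; the one definition is a
structure recording data and hypotheses (no named facts).

The sectors `X₁, X₂, X₃` of `BiCollar.TriData` (`TrisectionsMiddleSectors.lean`) are cut out of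
the closed `4`-manifold by the Morse function `f`, the unit-speed gradient-like field `U.ξ`
across the Heegaard level `Y = f⁻¹(a)` and the Heegaard function `g` on `Y`.  The remaining
Morse theory of the construction — the handle decompositions of `X₂` and of the handlebody
`H₂₃ = X₂ ∩ X₃` — takes place inside Milnor's charts of the critical points of index `2`
(Milnor 1965, Def. 3.1), where `f = a + η₂ - A + B` (`A = |x⃗|²`, `B = |y⃗|²`) and the
Heegaard function is Gay–Kirby's tube function `𝒯 = 1 - ε x₀²/A + (κ/η₂) A B` of the attaching
circles (`TrisectionsTubeModel.lean`).  This file fixes that setting as a structure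
`TriData.TubeFrame`:

* the unit field is a positive multiple `U.ξ = ρ_U • ζ` of a smooth gradient-like field `ζ`
  with Milnor's normal form in the charts, the charts being a system of `2`-handle boxes
  `HandleBoxes f ζ a η₂ ι` (`TrisectionsHandleBoxes.lean`) about the critical points of the
  level `a + η₂`;
* the top level is **low**: `c = a + η₂ + ν²` with `2ν² ≤ η₂`, so that the lid `{f = c}` of
  `H₂₃` crosses the charts and its belt circles `{x⃗ = 0, B = ν²}` lie in the boxes;
* on the thin tubes `{P_j = A·B < P₀}` of the level, `g` is affine in the tube function,
  `g = k_g 𝒯 + g₀`, and stays below `b - m₀` with `m₀ > 3ε` (`ε` the rounding width).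

Consequences proved here:

* `TubeFrame.hit_iff`, `TubeFrame.lam_eq` — hitting the level and the projection onto it are
  the same for `U.ξ` and for `ζ` (`FlowTimeChange.lean`);
* `TubeFrame.linkCondition` — the **link condition** of the assembly with margin `m₀ - ε`
  (`TrisectionsLinkCondition.lean`: the stable sets of the index-`2` points meet `Y` in the
  attaching circles, where `P_j = 0`);
* `TubeFrame.gFun_eq_of_P_lt`, `TubeFrame.gFun_le_of_P_lt` — **on the thin tubes the transported
  Heegaard function is the tube function**: `G = g ∘ λ - b = k_g 𝒯(coord_j) + g₀ - b ≤ -m₀`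
  at hitting points (conservation of `𝒯` and of `P` along the trajectories,
  `HandleBoxes.exists_levelProj_mem`);
* `TubeFrame.f_eq_c_of_mem_H₂₃_of_P_lt` — **the handlebody `H₂₃` crosses the thin tubes exactly
  along the lid `{f = c}`** (there `G ≤ -m₀ < -3ε`, so the rounded height is `M = f - c`).

## References

* D. Gay, R. Kirby, *Trisecting 4-manifolds*, Geom. Topol. 20 (2016), §4, Lemma 14 and proof
  of Thm. 4. [GayKirby2016]
* J. Milnor, *Lectures on the h-cobordism theorem* (1965), Def. 3.1, Thm. 3.4, proof of
  Thm. 3.12, Thm. 3.13, Thm. 4.1. [MilnorHCobordism1965]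
-/

open scoped Manifold ContDiff Topology
open Set Function Filter

noncomputable section

universe u

namespace Literature.Topology.FourManifolds

open Flow

variable {X : Type u} [TopologicalSpace X] [T2Space X] [CompactSpace X]
  [ChartedSpace (EuclideanSpace ℝ (Fin 4)) X] [IsManifold (𝓡 4) ∞ X]

namespace BiCollar

namespace TriData

variable {B : BiCollar X} (T : B.TriData)

/-- **The tube frame of the trisection construction.**  Over the `TriData` `T`: a smooth
gradient-like field `ζ` of `f` of which the unit field `U.ξ` is a positive multiple; a system
of `2`-handle boxes of `(f, ζ)` about the critical points of the level `a + η₂`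
(`HandleBoxes`, Milnor 1965, Def. 3.1), the unit band lying within `η₂` of the level; the low
top level `c = a + η₂ + ν²`, `2ν² ≤ η₂`; and the Heegaard function affine in Gay–Kirby's tube
function, `g = k_g 𝒯 + g₀ ≤ b - m₀`, on the thin tubes `{P_j < P₀}` of the level (`P₀ ≤ η₂²`,
`m₀ > 3ε`), with the critical points of `g` below `b` at least `2ε` below `b`.
[cite: GayKirby2016, §4, Lemma 14 and proof of Thm. 4] [cite: MilnorHCobordism1965, Def. 3.1] -/
structure TubeFrame (ι : Type) [Fintype ι] where
  /-- The un-normalised gradient-like field. -/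
  ζ : Π x : X, TangentSpace (𝓡 4) x
  /-- It is smooth. -/
  hζ : ContMDiff (𝓡 4) (𝓡 4).tangent ∞ fun x => (⟨x, ζ x⟩ : TangentBundle (𝓡 4) X)
  /-- It is gradient-like for `f`. -/
  hgl : IsGradientLike (𝓡 4) B.f ζ
  /-- The speed factor. -/
  ρU : X → ℝ
  /-- The speed factor is continuous. -/
  continuous_ρU : Continuous ρU
  /-- The speed factor is positive. -/
  ρU_pos : ∀ x, 0 < ρU x
  /-- `U.ξ = ρ_U • ζ`. -/
  U_eq : ∀ x, B.U.ξ x = ρU x • ζ x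
  /-- The height of the index-`2` critical level above `a`. -/
  η₂ : ℝ
  /-- The `2`-handle boxes of `(f, ζ)`. -/
  boxes : HandleBoxes B.f ζ B.a η₂ ι
  /-- The unit band lies within `η₂` of the level. -/
  band_le : B.U.δ ≤ η₂
  /-- The lid parameter. -/
  ν : ℝ
  /-- `ν > 0`. -/
  ν_pos : 0 < ν
  /-- The lid is low. -/
  two_nu_sq_le : 2 * ν ^ 2 ≤ η₂
  /-- The top level is `a + η₂ + ν²`. -/
  c_eq : T.c = B.a + η₂ + ν ^ 2
  /-- The slope of `g` against the tube function. -/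
  kg : ℝ
  /-- The offset of `g` against the tube function. -/
  g₀ : ℝ
  /-- The angular amplitude of the tube function. -/
  εT : ℝ
  /-- The radial coefficient of the tube function. -/
  κT : ℝ
  /-- The size of the thin tubes. -/
  P₀ : ℝ
  /-- The margin of `g` below `b` on the thin tubes. -/
  m₀ : ℝ
  /-- `k_g > 0`. -/
  kg_pos : 0 < kg
  /-- `ε_T ≥ 0`. -/
  εT_nonneg : 0 ≤ εT
  /-- `κ_T > 0`. -/
  κT_pos : 0 < κT
  /-- `P₀ > 0`. -/
  P₀_pos : 0 < P₀
  /-- The thin tubes are thin: `P₀ ≤ η₂²`. -/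
  P₀_le : P₀ ≤ η₂ ^ 2
  /-- `g = k_g 𝒯 + g₀` on the thin tubes of the level. -/
  g_tube : ∀ j (y : B.Y), RegularLevel.incl B.hf y ∈ (boxes.box j).chart.source →
    boxes.P j (RegularLevel.incl B.hf y) < P₀ →
    B.g y = kg * TubeModel.tube εT κT η₂ ((boxes.box j).coord (RegularLevel.incl B.hf y)) + g₀
  /-- `g ≤ b - m₀` on the thin tubes of the level. -/
  g_margin : ∀ j (y : B.Y), RegularLevel.incl B.hf y ∈ (boxes.box j).chart.source →
    boxes.P j (RegularLevel.incl B.hf y) < P₀ → B.g y ≤ B.b - m₀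
  /-- The margin beats the rounding width. -/
  lt_m₀ : 3 * T.ε < m₀
  /-- The critical points of `g` below `b` lie at least `2ε` below `b`. -/
  critgap : ∀ y : B.Y, IsMCriticalPt (𝓡 3) B.g y → B.g y < B.b → B.g y ≤ B.b - 2 * T.ε

namespace TubeFrame

variable {T} {ι : Type} [Fintype ι] (𝔉 : T.TubeFrame ι)

omit [T2Space X] [CompactSpace X] in
/-- `η₂ > 0`. [folklore] -/
theorem η₂_pos : 0 < 𝔉.η₂ := 𝔉.boxes.eta_pos

omit [T2Space X] [CompactSpace X] in
include 𝔉 in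
/-- `a < c`. [folklore] -/
theorem a_lt_c : B.a < T.c := by rw [𝔉.c_eq]; nlinarith [𝔉.η₂_pos, 𝔉.ν_pos]

omit [T2Space X] [CompactSpace X] in
/-- `c < a + 2η₂`: the lid is inside the band of the boxes. [folklore] -/
theorem c_lt : T.c < B.a + 2 * 𝔉.η₂ := by
  rw [𝔉.c_eq]; nlinarith [𝔉.η₂_pos, 𝔉.ν_pos, 𝔉.two_nu_sq_le]

omit [T2Space X] [CompactSpace X] in
/-- The margin in the link condition, `m₀ - ε ≥ 2ε`. [folklore] -/
theorem two_mul_ε_le : 2 * T.ε ≤ 𝔉.m₀ - T.ε := by linarith [𝔉.lt_m₀]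

/-! ### Hitting and the projection: `U.ξ` versus `ζ` -/

/-- **Hitting the level is the same for `U.ξ` and for `ζ`.** [cite: MilnorHCobordism1965, proof of Thm. 3.4] -/
theorem hit_iff (x : X) : B.Hit x ↔ Hits (flowθ 𝔉.hζ) B.f B.a x :=
  hits_flowθ_smul_iff 𝔉.hζ B.U.contMDiff 𝔉.U_eq 𝔉.continuous_ρU 𝔉.ρU_pos x

/-- **The projection onto the level is the same for `U.ξ` and for `ζ`.** [cite: MilnorHCobordism1965, Thm. 4.1] -/
theorem lam_eq {x : X} (hx : B.Hit x) : B.lam x = levelProj 𝔉.hζ B.f B.a x :=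
  𝔉.hgl.levelProj_smul_eq_of_level 𝔉.hζ B.U.contMDiff 𝔉.U_eq 𝔉.continuous_ρU 𝔉.ρU_pos
    T.Fr.isMorse (fun _ hy => B.not_isMCriticalPt_of_apply_eq_a hy) ((𝔉.hit_iff x).1 hx)

/-- The projection onto the level, as a point of `Y`, for `ζ`. [folklore] -/
theorem incl_lamLift_eq {x : X} (hx : B.Hit x) :
    RegularLevel.incl B.hf (B.lamLift x) = levelProj 𝔉.hζ B.f B.a x := by
  rw [B.incl_lamLift hx, 𝔉.lam_eq hx]

/-! ### The link condition -/

/-- **The link condition of the assembly** (`hL` of `exists_isBalancedGKTrisection_of_handles`)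
with margin `m₀ - ε`: every point of `Y` on a trajectory of `U.ξ` going to a critical point `q`
with `a < f q ≤ c` has `g < b - (m₀ - ε)`.  (Such `q` is one of the centres of the boxes; the
stable set of `U.ξ = ρ_U • ζ` is that of `ζ`, which meets `Y` in the attaching circle
`{B_j = 0}` of the box, where `P_j = 0 < P₀` and `g ≤ b - m₀`.) [cite: GayKirby2016, §4, Lemma 14] [cite: MilnorHCobordism1965, Thm. 3.13] -/
theorem linkCondition :
    ∀ q : X, IsMCriticalPt (𝓡 4) B.f q → B.a < B.f q → B.f q ≤ T.c →
      ∀ y : B.Y, RegularLevel.incl B.hf y ∈ stableSet (𝓡 4) B.U.ξ q → B.g y < B.b - (𝔉.m₀ - T.ε) := by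
  have hcrit : ∀ q, IsMCriticalPt (𝓡 4) B.f q → B.a < B.f q → B.f q ≤ T.c → ∃ j, q = 𝔉.boxes.cpt j :=
    fun q hq h₁ h₂ => 𝔉.boxes.crit_val q hq (by linarith [𝔉.η₂_pos]) (by linarith [𝔉.c_lt])
  refine T.Fr.linkCondition_of_milnorBoxes 𝔉.hζ 𝔉.hgl 𝔉.U_eq 𝔉.continuous_ρU 𝔉.ρU_pos 𝔉.boxes.box
    (fun j => ?_) (fun j => ?_) hcrit (fun j y hsrc hB _ => ?_)
  · rw [𝔉.boxes.apply_cpt j]; linarith [𝔉.boxes.eta_lt j, 𝔉.η₂_pos]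
  · rw [𝔉.boxes.apply_cpt j]; linarith [𝔉.η₂_pos]
  · have hP : 𝔉.boxes.P j (RegularLevel.incl B.hf y) < 𝔉.P₀ := by
      rw [HandleBoxes.P_def, HandleBoxes.B_def, hB, mul_zero]; exact 𝔉.P₀_pos
    linarith [𝔉.g_margin j y hsrc hP, T.ε_pos]

/-! ### The transported Heegaard function on the thin tubes -/

/-- A point outside `X₁` lies above `a - η₂` (`X₁ ⊇ {f ≤ c_low}`, `c_low > a - δ_U ≥ a - η₂`). [folklore] -/
theorem lt_f_of_not_mem_X₁ {x : X} (hx : x ∉ T.X₁) : B.a - 𝔉.η₂ < B.f x := by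
  have h1 : ¬ B.f x ≤ T.D.cLow := fun h => hx (T.D.preimage_Iic_cLow_subset h)
  linarith [T.D.sub_lt_cLow, 𝔉.band_le, not_le.1 h1]

/-- **On the thin tube, `G` is the tube function**: at a hitting point `x ∈ source_j` with
`P_j x < P₀` and `a - η₂ < f x < a + 2η₂`,
`G x = g (λ x) - b = k_g 𝒯(coord_j x) + g₀ - b`. [cite: GayKirby2016, §4, Lemma 14] -/
theorem gFun_eq_of_P_lt {j : ι} {x : X} (hsrc : x ∈ (𝔉.boxes.box j).chart.source)
    (hP : 𝔉.boxes.P j x < 𝔉.P₀) (hf₁ : B.a - 𝔉.η₂ < B.f x) (hf₂ : B.f x < B.a + 2 * 𝔉.η₂) (hx : B.Hit x) :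
    B.gFun x = 𝔉.kg * TubeModel.tube 𝔉.εT 𝔉.κT 𝔉.η₂ ((𝔉.boxes.box j).coord x) + 𝔉.g₀ - B.b := by
  have hx' := (𝔉.hit_iff x).1 hx
  have hP' : 𝔉.boxes.P j x < 2 * (𝔉.P₀ / 2) := by linarith
  obtain ⟨hmem, hPeq, htube⟩ := 𝔉.boxes.exists_levelProj_mem (hξ := 𝔉.hζ) 𝔉.hgl T.Fr.isMorse
    (show 2 * (𝔉.P₀ / 2) ≤ 𝔉.η₂ ^ 2 by linarith [𝔉.P₀_le]) hsrc hP' hf₁ hf₂ hx'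
  have hy : RegularLevel.incl B.hf (B.lamLift x) = levelProj 𝔉.hζ B.f B.a x := 𝔉.incl_lamLift_eq hx
  have h1 := 𝔉.g_tube j (B.lamLift x) (by rw [hy]; exact hmem) (by rw [hy, hPeq]; exact hP)
  rw [hy, htube] at h1
  show B.g (B.lamLift x) - B.b = _
  rw [h1]

/-- **On the thin tube, `G ≤ -m₀`** at hitting points. [cite: GayKirby2016, §4, Lemma 14] -/
theorem gFun_le_of_P_lt {j : ι} {x : X} (hsrc : x ∈ (𝔉.boxes.box j).chart.source)
    (hP : 𝔉.boxes.P j x < 𝔉.P₀) (hf₁ : B.a - 𝔉.η₂ < B.f x) (hf₂ : B.f x < B.a + 2 * 𝔉.η₂) (hx : B.Hit x) :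
    B.gFun x ≤ -𝔉.m₀ := by
  have hx' := (𝔉.hit_iff x).1 hx
  have hP' : 𝔉.boxes.P j x < 2 * (𝔉.P₀ / 2) := by linarith
  obtain ⟨hmem, hPeq, -⟩ := 𝔉.boxes.exists_levelProj_mem (hξ := 𝔉.hζ) 𝔉.hgl T.Fr.isMorse
    (show 2 * (𝔉.P₀ / 2) ≤ 𝔉.η₂ ^ 2 by linarith [𝔉.P₀_le]) hsrc hP' hf₁ hf₂ hx'
  have hy : RegularLevel.incl B.hf (B.lamLift x) = levelProj 𝔉.hζ B.f B.a x := 𝔉.incl_lamLift_eq hx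
  have h1 := 𝔉.g_margin j (B.lamLift x) (by rw [hy]; exact hmem) (by rw [hy, hPeq]; exact hP)
  show B.g (B.lamLift x) - B.b ≤ _
  linarith

/-- **`H₂₃` crosses the thin tubes along the lid**: a point of `H₂₃ ∖ X₁` in `source_j` with
`P_j < P₀` has `f = c`.  (A non-hitting such point is a sheet top; at a hitting one
`M = 0` with `G ≤ -m₀ < -3ε` forces `w ≥ ε`, so `M = f - c`.) [cite: GayKirby2016, §4, Lemma 14] -/
theorem f_eq_c_of_mem_H₂₃_of_P_lt {j : ι} {x : X} (hx : x ∈ T.H₂₃) (hx₁ : x ∉ T.X₁)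
    (hsrc : x ∈ (𝔉.boxes.box j).chart.source) (hP : 𝔉.boxes.P j x < 𝔉.P₀) : B.f x = T.c := by
  by_cases hh : B.Hit x
  · have hG := 𝔉.gFun_le_of_P_lt hsrc hP (𝔉.lt_f_of_not_mem_X₁ hx₁)
      ((T.f_le_c_of_mem_H₂₃ hx).trans_lt 𝔉.c_lt) hh
    have hM : T.M x = 0 := T.M_eq_zero_of_mem_H₂₃ hx hh
    have hle := T.M_le x
    rw [hM] at hle
    -- `max (G, f - c) ≥ -ε`, `G ≤ -m₀ < -3ε` ⇒ `f - c ≥ -ε`… precisely `w ≥ ε`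
    have hw : T.ε ≤ T.w x := by
      show T.ε ≤ B.f x - T.c - B.gFun x
      have h3 := 𝔉.lt_m₀
      have hε := T.ε_pos
      rcases le_total (B.gFun x) (B.f x - T.c) with h | h
      · rw [max_eq_right h] at hle; linarith
      · rw [max_eq_left h] at hle; linarith
    have := T.M_eq_sub_of_le_w hw
    rw [hM] at this
    linarith
  · exact T.f_eq_c_of_mem_H₂₃ 𝔉.two_mul_ε_le 𝔉.linkCondition hx hx₁ hh

/-- On `H₂₃`, `B_j = f - a - η₂ + A_j ≤ ν² + A_j` (as `f ≤ c`). [folklore] -/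
theorem B_le_of_mem_H₂₃ {j : ι} {x : X} (hx : x ∈ T.H₂₃) (hsrc : x ∈ (𝔉.boxes.box j).chart.source) :
    𝔉.boxes.B j x ≤ 𝔉.ν ^ 2 + 𝔉.boxes.A j x := by
  have h1 := 𝔉.boxes.apply_eq hsrc
  have h2 := T.f_le_c_of_mem_H₂₃ hx
  rw [𝔉.c_eq] at h2
  linarith

/-- **The core zones meet `H₂₃` along the lid**: if `a_R (ν² + a_R) ≤ P₀`, a point of
`H₂₃ ∖ X₁` in `source_j` with `A_j < a_R` has `f = c`. [cite: GayKirby2016, §4, Lemma 14] -/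
theorem f_eq_c_of_mem_H₂₃_of_A_lt {aR : ℝ} (haR : aR * (𝔉.ν ^ 2 + aR) ≤ 𝔉.P₀) {j : ι} {x : X}
    (hx : x ∈ T.H₂₃) (hx₁ : x ∉ T.X₁) (hsrc : x ∈ (𝔉.boxes.box j).chart.source)
    (hA : 𝔉.boxes.A j x < aR) : B.f x = T.c := by
  apply 𝔉.f_eq_c_of_mem_H₂₃_of_P_lt hx hx₁ hsrc
  have hA0 := 𝔉.boxes.A_nonneg j x
  have hB0 := 𝔉.boxes.B_nonneg j x
  have hB := 𝔉.B_le_of_mem_H₂₃ hx hsrc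
  rw [HandleBoxes.P_def]
  calc 𝔉.boxes.A j x * 𝔉.boxes.B j x ≤ 𝔉.boxes.A j x * (𝔉.ν ^ 2 + 𝔉.boxes.A j x) :=
        mul_le_mul_of_nonneg_left hB hA0
    _ < aR * (𝔉.ν ^ 2 + aR) := by nlinarith [𝔉.ν_pos]
    _ ≤ 𝔉.P₀ := haR

end TubeFrame

end TriData

end BiCollar

end Literature.Topology.FourManifolds

end
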